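import Summits.CriticalPhenomena.PercolationContinuityZ3.Theorems.Transplant.GrigorchukTimesZResidueScope
import Summits.CriticalPhenomena.PercolationContinuityZ3.Theorems.Transplant.BenjaminiSchrammResidue
import HarnessLib

/-!
# Conjecture 4 ON THE TWO CERTIFIED WITNESSES of the residue node — `Cay(𝔊; a, b, c, d)` and `Cay(𝔊 × ℤ; a, b, c, d, z)` — as two NAMED STATEMENTS
# (`@[conjecture]`, NOT asserted), with their derivation from the residue node and from Conjecture 4

Definitions file (`--supports stmt-CriticalPhenomena-4575`), stmt lineage (stmt-g40), lane `prim-bschramm`; builds on p205010 (kernel theorem, internal audit signed;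
external expert review pending) — nothing in this file uses p205010.  No instance, no notation, no sorry; TWO statements recorded `@[conjecture]` (NOT asserted) and
their derivations from existing nodes proved.  Typed under director-frontier g14's word (B) #8611 and lead g27's GO #8626 (statement-first: the planners' crux on
[W] needs a DECL + p-id to point at; the statement ITEM itself is a planner act).

CONTEXT.  The open residue node `BenjaminiSchramm1996_conj4_amenableSubexponential` («StatementPolynomialGrowth» :76; Benjamini–Schramm Conj. 4 on amenable
quasi-transitive graphs WITHOUT exponential growth; equivalent to Conjecture 4 itself, `conj4_iff_amenableSubexponential` in «BenjaminiSchrammResidue») has two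
KERNEL-CERTIFIED members of its scope that no theorem, node or route of the lane decides — the planners' CANDIDATE WITNESSES of VERDICTS :439 / :447:
the standard Cayley graph `stdCay = Cay(𝔊; a, b, c, d)` of the first Grigorchuk group («GrigorchukResidueScope» p625451: connected, quasi-transitive, amenable,
NOT of exponential growth — indeed of intermediate growth, p618494 —, `p_c < 1` by Muchnik–Pak, p607347) and `gzCay = Cay(𝔊 × ℤ; a, b, c, d, z)`
(«GrigorchukTimesZResidueScope» p645243: the same five hypotheses, kernel).  This file NAMES the two conclusions:
* `Grigorchuk.stdCay_conj4 : Prop := ∀ v, theta stdCay v (criticalProbIOf stdCay v) = 0` — `θ_v(p_c) = 0` at every vertex of `Cay(𝔊; a, b, c, d)`;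
* `Grigorchuk.gzCay_conj4 : Prop := ∀ x, theta gzCay x (criticalProbIOf gzCay x) = 0` — the same on `Cay(𝔊 × ℤ; a, b, c, d, z)`
(binder shape = V164's kernel theorem `Grigorchuk.cay_criticalContinuity (v) : theta Cay v (criticalProbIOf Cay v) = 0` for Bartholdi–Erschler's graph, p636152),
and proves `stdCay_conj4_of_conj4_amenableSubexponential` / `gzCay_conj4_of_conj4_amenableSubexponential` (the residue node, taken as a HYPOTHESIS, implies each —
literally p625451's / p645243's scope theorems), `stdCay_conj4_of_conj4` / `gzCay_conj4_of_conj4` (so does Conjecture 4, via «BenjaminiSchrammResidue»), and the plain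
conjunction packages `stdCay_conj4_iff` / `gzCay_conj4_iff` with the KERNEL first conjunct `p_c < 1` (the lane's `criticalProb < 1 ∧ theta (p_c) = 0` instance shape).
STATUS: `θ(p_c) = 0` on either graph is NOT PROVED, in the tree or in print; NO door of the lane applies to either witness (VERDICTS :442 / :445: Aut(Cay(𝔊; a,b,c,d)) = 𝔊
has character rank 0, Aut(Cay(𝔊 × ℤ; a,b,c,d,z)) = (𝔊 × ℤ) ⋊ C₂ has rank 1; the end-state / chart / quasi-step nodes need rank 2); the doors of record are D1–D4 of
VERDICTS :447 (a heat-kernel input of Hermon–Hutchcroft type; a one-direction renormalisation for `X □ ℤ`; a q.i. / commensurability transfer; the residue node itself).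
The residue node, `BenjaminiSchramm1996_conj4_endState` and Conjecture 4 stay OPEN; nothing here bears on their truth.
[cite: BenjaminiSchramm1996, Conj. 4] [cite: HermonHutchcroft2021, §1] [cite: MuchnikPak2001, Thm. 1] [cite: Grigorchuk1984, Thm.]
-/

noncomputable section

namespace Summit.CriticalPhenomena.PercolationContinuityZ3.Theorems.Transplant

namespace Grigorchuk

open SimpleGraph Literature.Barriers.CriticalPhenomena Literature.Probability.Percolation Literature.Probability.LatticeModels
open scoped Classical

/-! ### The two witness statements (NOT asserted) -/

/-- **Conjecture node (NOT asserted): `θ_v(p_c) = 0` at every vertex of the standard Cayley graph `Cay(𝔊; a, b, c, d)` of the first Grigorchuk group** —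
Benjamini–Schramm's Conjecture 4 for this one graph, the planners' first candidate witness (VERDICTS :439 / :447): amenable, intermediate growth, `p_c < 1`
(inside the scope of the open residue node, kernel p625451); NOT PROVED in tree or print; no door of the lane applies (Aut = 𝔊, character rank 0, VERDICTS :442);
doors D1–D4 of VERDICTS :447. [cite: BenjaminiSchramm1996, Conj. 4] [cite: HermonHutchcroft2021, §1] -/
@[conjecture] def stdCay_conj4 : Prop :=
  ∀ v : ↥grigorchukGroup, theta stdCay v (criticalProbIOf stdCay v) = 0

/-- **Conjecture node (NOT asserted): `θ_x(p_c) = 0` at every vertex of `Cay(𝔊 × ℤ; a, b, c, d, z)`** (`= Cay(𝔊; a, b, c, d) □ ℤ`) — Conjecture 4 for this one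
graph, the planners' second candidate witness (VERDICTS :439 / :447): amenable, subexponential growth, `p_c < p_c(Cay(𝔊; a,b,c,d)) < 1` (inside the scope of the open
residue node, kernel p645243); NOT PROVED in tree or print; no door of the lane applies (Aut = (𝔊 × ℤ) ⋊ C₂, character rank 1, VERDICTS :445); doors D1–D4 of
VERDICTS :447. [cite: BenjaminiSchramm1996, Conj. 4] [cite: HermonHutchcroft2021, §1] -/
@[conjecture] def gzCay_conj4 : Prop :=
  ∀ x : GZ, theta gzCay x (criticalProbIOf gzCay x) = 0

/-! ### Derivations from the existing nodes (the nodes are HYPOTHESES, never asserted) -/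

/-- **The residue node implies `stdCay_conj4`** (p625451's scope theorem for `Cay(𝔊; a, b, c, d)`, restated against the named statement).
[cite: BenjaminiSchramm1996, Conj. 4] -/
theorem stdCay_conj4_of_conj4_amenableSubexponential (h : BenjaminiSchramm1996_conj4_amenableSubexponential) : stdCay_conj4 :=
  fun v => grigorchuk_cayley_theta_eq_zero_of_conj4_amenableSubexponential h v

/-- **The residue node implies `gzCay_conj4`** (p645243's scope theorem for `Cay(𝔊 × ℤ; a, b, c, d, z)`). [cite: BenjaminiSchramm1996, Conj. 4] -/
theorem gzCay_conj4_of_conj4_amenableSubexponential (h : BenjaminiSchramm1996_conj4_amenableSubexponential) : gzCay_conj4 :=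
  fun x => gz_theta_eq_zero_of_conj4_amenableSubexponential h x

/-- **Conjecture 4 implies `stdCay_conj4`** (through `conj4_amenableSubexponential_of_conj4`, «BenjaminiSchrammResidue»). [cite: BenjaminiSchramm1996, Conj. 4] -/
theorem stdCay_conj4_of_conj4 (h : BenjaminiSchramm1996_conj4) : stdCay_conj4 :=
  stdCay_conj4_of_conj4_amenableSubexponential (conj4_amenableSubexponential_of_conj4 h)

/-- **Conjecture 4 implies `gzCay_conj4`** (through `conj4_amenableSubexponential_of_conj4`, «BenjaminiSchrammResidue»). [cite: BenjaminiSchramm1996, Conj. 4] -/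
theorem gzCay_conj4_of_conj4 (h : BenjaminiSchramm1996_conj4) : gzCay_conj4 :=
  gzCay_conj4_of_conj4_amenableSubexponential (conj4_amenableSubexponential_of_conj4 h)

/-! ### The lane's instance shape `p_c < 1 ∧ θ(p_c) = 0` (the first conjunct is kernel) -/

/-- `stdCay_conj4` as the conjunction package `p_c < 1 ∧ θ(p_c) = 0` at every vertex — the first conjunct is KERNEL (Muchnik–Pak for `𝔊`, p607347,
`grigorchukGroup_criticalProb_lt_one`), so the node is exactly the missing second conjunct; an honest equivalence, no new content.
[cite: MuchnikPak2001, Thm. 1] [cite: BenjaminiSchramm1996, Conj. 4] -/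
theorem stdCay_conj4_iff : stdCay_conj4 ↔ ∀ v : ↥grigorchukGroup, criticalProb stdCay v < 1 ∧ theta stdCay v (criticalProbIOf stdCay v) = 0 :=
  ⟨fun h v => ⟨grigorchukGroup_criticalProb_lt_one _ closure_gens_finset v, h v⟩, fun h v => (h v).2⟩

/-- `gzCay_conj4` as the conjunction package `p_c < 1 ∧ θ(p_c) = 0` at every vertex — the first conjunct is KERNEL (`gzCay_criticalProb_lt_one`, p645243);
an honest equivalence, no new content. [cite: MuchnikPak2001, Thm. 1] [cite: BenjaminiSchramm1996, Conj. 4] -/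
theorem gzCay_conj4_iff : gzCay_conj4 ↔ ∀ x : GZ, criticalProb gzCay x < 1 ∧ theta gzCay x (criticalProbIOf gzCay x) = 0 :=
  ⟨fun h x => ⟨gzCay_criticalProb_lt_one x, h x⟩, fun h x => (h x).2⟩

end Grigorchuk

end Summit.CriticalPhenomena.PercolationContinuityZ3.Theorems.Transplant

end
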